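import Literature.Analysis.FluidPDE.JetSecondOrderEstimates
import Literature.Analysis.FluidPDE.JetStressEstimates
import HarnessLib

/-!
# The intermittent-jet perturbation: sup summary (`C¹` size of `w`, sup size of the new stress)

Analysis/FluidPDE support file (everything proved): the crude uniform bounds of `w`, `∂ᵢw`, `∂ₜw`
(for (2.3) of Buckmaster–Vicol, Ann. of Math. 189 (2019)) and of the new stress
`perturbedStressV ν v w' ζ (S₁ Rc) f` (pointwise, for the next mollification step), assembled
from the sibling files; the constants of the Morrey / `Δ⁻¹`-gradient / antidivergence sup bounds
enter as hypotheses.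

## References

* T. Buckmaster, V. Vicol, Ann. of Math. 189 (2019) = arXiv:1709.10033, §2 (2.3). [`BuckmasterVicol2019Annals`]
* T. Buckmaster, V. Vicol, EMS Surv. Math. Sci. 6 (2019) = arXiv:1901.09023, §7.6. [`BuckmasterVicol2020`]
-/

noncomputable section

open MeasureTheory Set Filter Topology Function
open scoped InnerProductSpace ContDiff ENNReal NNReal

namespace Literature.Analysis.FluidPDE

namespace JetStep

open Literature.Analysis.FunctionSpaces FunctionSpaces.Torus Mikado NashGeometric Jet

local notation "𝕋³" => UnitAddTorus (Fin 3)
local notation "E³" => EuclideanSpace ℝ (Fin 3)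
local notation "Idx" => Index (Fin 3)

namespace Datum

/-! ## Named sizes -/

/-- `sup‖wp‖`. [folklore] -/
def wpSup (D : Datum) (A₀ B : ℝ) : ℝ := NN * (3 * A₀ * (B * D.κ ^ (1 / 2 : ℝ) * (B * D.μ)))

/-- `sup‖wpc - wp‖`. [folklore] -/
def wcSup (D : Datum) (A₀ A₁ B : ℝ) : ℝ := NN * (3 * (B ^ 2 * (5 * A₀ * D.κ ^ (3 / 2 : ℝ) + 36 * A₁ * D.κ ^ (1 / 2 : ℝ) * (D.σ : ℝ)⁻¹)))

/-- `sup‖X‖`. [folklore] -/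
def XSup (D : Datum) (A₀ B : ℝ) : ℝ := NN * (6 * D.mup⁻¹ * A₀ ^ 2 * (B ^ 4 * D.κ * D.μ ^ 2))

/-- `sup|∂F|`-size. [folklore] -/
def dFSup (D : Datum) (A₀ H₁ B : ℝ) : ℝ := H₁ * (B ^ 4 * D.κ * D.μ ^ 2) + A₀ ^ 2 * (B ^ 4 * (6 * D.σ * D.κ ^ 2 * D.μ ^ 2 + 2 * D.σ * D.κ * D.μ ^ 3))

/-- `sup|∂ᵢζ|`. [folklore] -/
def zSup (D : Datum) (A₀ H₁ B K : ℝ) : ℝ := 3 * (K * (3 * (NN * (3 * D.mup⁻¹ * D.dFSup A₀ H₁ B))))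

/-- `sup‖w‖`. [folklore] -/
def wSup (D : Datum) (A₀ A₁ H₁ B K : ℝ) : ℝ := D.wpSup A₀ B + D.wcSup A₀ A₁ B + D.XSup A₀ B + 3 * D.zSup A₀ H₁ B K

/-- `sup‖∂ᵢwpc‖`. [folklore] -/
def dwpcSup (D : Datum) (A₀ A₁ A₂ B : ℝ) : ℝ := NN *
      (3 * A₁ * (B ^ 2 * D.κ ^ (1 / 2 : ℝ) * D.μ) + 9 * D.σ * A₀ * (B ^ 2 * D.κ ^ (3 / 2 : ℝ) * D.μ) +
       3 * A₀ * (B ^ 2 * D.κ ^ (1 / 2 : ℝ) * (D.σ * D.μ ^ 2)) + 41 * D.σ * A₁ * (3 * B ^ 2 * D.κ ^ (3 / 2 : ℝ) * (D.σ : ℝ)⁻¹) +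
       15 * D.σ ^ 2 * A₀ * (3 * B ^ 2 * D.κ ^ (5 / 2 : ℝ) * (D.σ : ℝ)⁻¹) + 5 * D.σ * A₀ * (3 * B ^ 2 * D.κ ^ (3 / 2 : ℝ) * D.μ) +
       12 * A₁ * (3 * B ^ 2 * D.κ ^ (1 / 2 : ℝ) * D.μ) + 12 * A₂ * (3 * B ^ 2 * D.κ ^ (1 / 2 : ℝ) * (D.σ : ℝ)⁻¹))

/-- `sup‖∂ᵢX‖`. [folklore] -/
def dXSup (D : Datum) (A₀ H₁ B : ℝ) : ℝ := NN * (3 * D.mup⁻¹ * D.dFSup A₀ H₁ B)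

/-- `sup|∂ₖ∂ᵢζ|`. [folklore] -/
def zzSup (D : Datum) (A₀ H₁ H₂ B Cψ K : ℝ) : ℝ := K * (3 * (NN * (9 * D.mup⁻¹ * D.ddFSup A₀ H₁ H₂ B Cψ)))

/-- `sup‖∂ᵢw‖`. [folklore] -/
def dwSup (D : Datum) (A₀ A₁ A₂ H₁ H₂ B Cψ K : ℝ) : ℝ := D.dwpcSup A₀ A₁ A₂ B + D.dXSup A₀ H₁ B + 3 * D.zzSup A₀ H₁ H₂ B Cψ K

/-- `sup‖∂ₜwpc‖`. [folklore] -/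
def dtwpcSup (D : Datum) (A₀ A₁ A₂ B : ℝ) : ℝ := NN *
      (3 * A₁ * (B ^ 2 * D.κ ^ (1 / 2 : ℝ) * D.μ) + 15 * D.σ * D.mup * A₀ * (B ^ 2 * D.κ ^ (3 / 2 : ℝ) * D.μ) +
       (5 * D.σ + 60 * D.σ * D.mup) * A₁ * (3 * B ^ 2 * D.κ ^ (3 / 2 : ℝ) * (D.σ : ℝ)⁻¹) +
       25 * D.σ ^ 2 * D.mup * A₀ * (3 * B ^ 2 * D.κ ^ (5 / 2 : ℝ) * (D.σ : ℝ)⁻¹) + 12 * A₂ * (3 * B ^ 2 * D.κ ^ (1 / 2 : ℝ) * (D.σ : ℝ)⁻¹))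

/-- `sup|Ḟ|`. [folklore] -/
def FdotSup (D : Datum) (A₀ H₁ B : ℝ) : ℝ := H₁ * (B ^ 4 * D.κ * D.μ ^ 2) + 10 * D.σ * D.mup * A₀ ^ 2 * (B ^ 4 * D.κ ^ 2 * D.μ ^ 2)

/-- `sup‖∂ₜX‖`. [folklore] -/
def dtXSup (D : Datum) (A₀ H₁ B : ℝ) : ℝ := NN * (6 * D.mup⁻¹ * D.FdotSup A₀ H₁ B)

/-- `sup|∂ᵢ∂ₜζ|`. [folklore] -/
def zdotSup (D : Datum) (A₀ H₁ H₂ B K₁ : ℝ) : ℝ := K₁ * (NN * (9 * D.mup⁻¹ * D.dFdotSup A₀ H₁ H₂ B))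

/-- `sup‖∂ₜw‖`. [folklore] -/
def dtwSup (D : Datum) (A₀ A₁ A₂ H₁ H₂ B K₁ : ℝ) : ℝ := D.dtwpcSup A₀ A₁ A₂ B + D.dtXSup A₀ H₁ B + 3 * D.zdotSup A₀ H₁ H₂ B K₁

variable {D : Datum} (h : D.Valid) {A₀ A₁ A₂ H₁ H₂ B Cψ : ℝ} {K K₁ : ℝ≥0} (hA : D.AmpBounds A₀ A₁ A₂ H₁ H₂)
  (hB : ∀ x t, Jet.Bounds B (D.J x) D.s x t) (hB1 : 1 ≤ B)
  (hCψ : ∀ (x : Idx) (i l : Fin 3) (y : 𝕋³), |Torus.partialDeriv i (Torus.partialDeriv l (Jet.psiJ (D.J x) D.s x)) y| ≤ Cψ * (D.σ : ℝ) ^ 2 * D.μ ^ 3)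
  (hK : ∀ φ : 𝕋³ → ℝ, Torus.IsSmooth φ → ∀ (i j : Fin 3) (y : 𝕋³), ‖Torus.partialDeriv i (Torus.partialDeriv j φ) y‖ₑ ≤
      K * ∑ m, eLpNorm (Torus.partialDeriv m (Torus.laplacian φ)) (ENNReal.ofReal ((Fintype.card (Fin 3) : ℝ) + 2)) volume)
  (hK₁ : ∀ g : 𝕋³ → ℝ, Torus.IsSmooth g → ∀ (i : Fin 3) (y : 𝕋³), ‖Torus.partialDeriv i (Torus.invLaplacian g) y‖ₑ ≤ K₁ * eLpNorm g ⊤ volume)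

include h hA hB hB1

/-- **`sup‖w‖ ≤ wSup`**. [cite: BuckmasterVicol2019Annals, §2 (2.3)] -/
theorem norm_w_le_sup (hK : ∀ φ : 𝕋³ → ℝ, Torus.IsSmooth φ → ∀ (i j : Fin 3) (y : 𝕋³), ‖Torus.partialDeriv i (Torus.partialDeriv j φ) y‖ₑ ≤
      K * ∑ m, eLpNorm (Torus.partialDeriv m (Torus.laplacian φ)) (ENNReal.ofReal ((Fintype.card (Fin 3) : ℝ) + 2)) volume)
    {t : ℝ} (ht : t ∈ Icc 0 D.T) (y : 𝕋³) : ‖D.w t y‖ ≤ D.wSup A₀ A₁ H₁ B K := by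
  have hζ : Torus.IsSmooth (D.zeta t) := (smooth_zeta h).isSmooth_slice ht
  have e : D.w t y = D.wp t y + (D.wpc t y - D.wp t y) + D.X t y + Torus.gradient (D.zeta t) y := by
    rw [show D.w t y = D.w' t y + Torus.gradient (D.zeta t) y from rfl, show D.w' t y = D.wpc t y + D.X t y from rfl]; abel
  have hg : ‖Torus.gradient (D.zeta t) y‖ ≤ 3 * D.zSup A₀ H₁ B K := by
    refine (norm_gradient_le (hζ.isContDiff (by simp)) y).trans ?_
    calc ∑ i, |Torus.partialDeriv i (D.zeta t) y| ≤ ∑ _i : Fin 3, D.zSup A₀ H₁ B K :=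
          Finset.sum_le_sum fun i _ => abs_partialDeriv_zeta_le_sup h hA hB hB1 hK ht i y
      _ = 3 * D.zSup A₀ H₁ B K := by simp only [Finset.sum_const, Finset.card_univ, Fintype.card_fin, nsmul_eq_mul, Nat.cast_ofNat]
  rw [e]
  calc _ ≤ ‖D.wp t y‖ + ‖D.wpc t y - D.wp t y‖ + ‖D.X t y‖ + ‖Torus.gradient (D.zeta t) y‖ :=
        (norm_add_le _ _).trans (add_le_add ((norm_add_le _ _).trans (add_le_add (norm_add_le _ _) le_rfl)) le_rfl)
    _ ≤ D.wpSup A₀ B + D.wcSup A₀ A₁ B + D.XSup A₀ B + 3 * D.zSup A₀ H₁ B K :=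
        add_le_add (add_le_add (add_le_add (norm_wp_le_sup h hB hB1 hA ht y) (norm_wc_le_sup h hB hB1 hA ht y)) (norm_X_le_sup h hB hB1 hA ht y)) hg

include hCψ in
/-- **`sup‖∂ᵢw‖ ≤ dwSup`**. [cite: BuckmasterVicol2019Annals, §2 (2.3)] -/
theorem norm_partialDeriv_w_le_sup (hK : ∀ φ : 𝕋³ → ℝ, Torus.IsSmooth φ → ∀ (i j : Fin 3) (y : 𝕋³), ‖Torus.partialDeriv i (Torus.partialDeriv j φ) y‖ₑ ≤
      K * ∑ m, eLpNorm (Torus.partialDeriv m (Torus.laplacian φ)) (ENNReal.ofReal ((Fintype.card (Fin 3) : ℝ) + 2)) volume)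
    {t : ℝ} (ht : t ∈ Icc 0 D.T) (i : Fin 3) (y : 𝕋³) :
    ‖Torus.partialDeriv i (D.w t) y‖ ≤ D.dwSup A₀ A₁ A₂ H₁ H₂ B Cψ K := by
  have hwpc : Torus.IsSmooth (D.wpc t) := (smooth_wpc h).isSmooth_slice ht
  have hX : Torus.IsSmooth (D.X t) := (smooth_X h).isSmooth_slice ht
  have hζ : Torus.IsSmooth (D.zeta t) := (smooth_zeta h).isSmooth_slice ht
  have e : Torus.partialDeriv i (D.w t) y = Torus.partialDeriv i (D.wpc t) y + Torus.partialDeriv i (D.X t) y +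
      Torus.partialDeriv i (Torus.gradient (D.zeta t)) y := by
    have := (((hwpc.hasDerivAt_line_zero i y).add (hX.hasDerivAt_line_zero i y)).add (hζ.gradient.hasDerivAt_line_zero i y))
    exact this.deriv
  rw [e]
  have hg : ‖Torus.partialDeriv i (Torus.gradient (D.zeta t)) y‖ ≤ 3 * D.zzSup A₀ H₁ H₂ B Cψ K := by
    refine (norm_partialDeriv_gradient_le hζ i y).trans ?_
    calc ∑ j, |Torus.partialDeriv i (Torus.partialDeriv j (D.zeta t)) y| ≤ ∑ _j : Fin 3, D.zzSup A₀ H₁ H₂ B Cψ K :=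
          Finset.sum_le_sum fun j _ => abs_partialDeriv_partialDeriv_zeta_le_sup h hA hB hB1 hCψ hK ht i j y
      _ = _ := by simp only [Finset.sum_const, Finset.card_univ, Fintype.card_fin, nsmul_eq_mul, Nat.cast_ofNat]
  exact (norm_add_le _ _).trans (add_le_add ((norm_add_le _ _).trans (add_le_add (norm_partialDeriv_wpc_le_sup h hA hB hB1 ht i y)
    (norm_partialDeriv_X_le_sup h hA hB hB1 ht i y))) hg)

/-- **`sup‖∂ₜw‖ ≤ dtwSup`**. [cite: BuckmasterVicol2019Annals, §2 (2.3)] -/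
theorem norm_timeDerivWithin_w_le_sup
    (hK₁ : ∀ g : 𝕋³ → ℝ, Torus.IsSmooth g → ∀ (i : Fin 3) (y : 𝕋³), ‖Torus.partialDeriv i (Torus.invLaplacian g) y‖ₑ ≤ K₁ * eLpNorm g ⊤ volume)
    {t : ℝ} (ht : t ∈ Icc 0 D.T) (y : 𝕋³) :
    ‖Torus.timeDerivWithin (Icc 0 D.T) D.w t y‖ ≤ D.dtwSup A₀ A₁ A₂ H₁ H₂ B K₁ := by
  rw [timeDerivWithin_w h ht y]
  have hzd : Torus.IsSmooth (D.zetadot t) := (smooth_zetadot h).isSmooth_slice ht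
  have hg : ‖Torus.gradient (D.zetadot t) y‖ ≤ 3 * D.zdotSup A₀ H₁ H₂ B K₁ := by
    refine (norm_gradient_le (hzd.isContDiff (by simp)) y).trans ?_
    calc ∑ i, |Torus.partialDeriv i (D.zetadot t) y| ≤ ∑ _i : Fin 3, D.zdotSup A₀ H₁ H₂ B K₁ :=
          Finset.sum_le_sum fun i _ => abs_partialDeriv_zetadot_le_sup h hA hB hB1 hK₁ ht i y
      _ = _ := by simp only [Finset.sum_const, Finset.card_univ, Fintype.card_fin, nsmul_eq_mul, Nat.cast_ofNat]
  exact (norm_add_le _ _).trans (add_le_add ((norm_add_le _ _).trans (add_le_add (norm_timeDerivWithin_wpc_le_sup h hA hB hB1 ht y)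
    (norm_timeDerivWithin_X_le_sup h hA hB hB1 ht y))) hg)

/-! ## The sup size of the new stress -/

omit hB hB1 in
/-- `‖f₂‖, ‖f₃‖, ‖S_osc‖` pointwise (sup of `∂Ψ` via `K₁`). [folklore] -/
theorem norm_f₂_f₃_Sosc_le
    (hK₁ : ∀ g : 𝕋³ → ℝ, Torus.IsSmooth g → ∀ (i : Fin 3) (y : 𝕋³), ‖Torus.partialDeriv i (Torus.invLaplacian g) y‖ₑ ≤ K₁ * eLpNorm g ⊤ volume)
    {t : ℝ} (ht : t ∈ Icc 0 D.T) {Φ : ℝ} (hΦ : ∀ x y, |Jet.fastF (D.J x) D.s x t y - 1| ≤ Φ) (y : 𝕋³) :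
    ‖D.f₂ t y‖ ≤ NN * ((2 * 3 + 1) * (27 * H₂) * (3 * ((K₁ : ℝ) * Φ))) ∧
    ‖D.f₃ t y‖ ≤ NN * (3 * D.mup⁻¹ * (H₁ * (Φ + 1))) ∧
    ‖D.Sosc t y‖ ≤ NN * (2 * (27 * H₁) * (3 * ((K₁ : ℝ) * Φ))) := by
  have hmup := (pos h).2.2.2.1
  have hH1 := hA.hH₁; have hH2 := hA.hH₂
  have hΦ0 : 0 ≤ Φ := (abs_nonneg _).trans (hΦ (Classical.arbitrary _) y)
  have hΨ : ∀ x, Torus.IsSmooth (D.Psi x t) := fun x => (smooth_Psi h x).isSmooth_slice ht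
  have hcv : ∀ x, Torus.IsSmooth (D.cvec x t) := fun x => (smooth_cvec h x).isSmooth_slice ht
  -- sup of `∂ₗΨ`
  have hdΨ : ∀ x l z, |Torus.partialDeriv l (D.Psi x t) z| ≤ (K₁ : ℝ) * Φ := by
    intro x l z
    have hg : Torus.IsSmooth (fun z => Jet.fastF (D.J x) D.s x t z - 1) := ((smooth_fastF h x).isSmooth_slice ht).sub (Torus.isSmooth_const _)
    have h1 := hK₁ _ hg l z
    have h2 : eLpNorm (fun z => Jet.fastF (D.J x) D.s x t z - 1) ⊤ volume ≤ ENNReal.ofReal Φ :=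
      Torus.eLpNorm_le_of_forall_norm_le (fun z => by rw [Real.norm_eq_abs]; exact hΦ x z) _
    have h3 : ‖Torus.partialDeriv l (Torus.invLaplacian fun z => Jet.fastF (D.J x) D.s x t z - 1) z‖ₑ ≤ ENNReal.ofReal ((K₁ : ℝ) * Φ) := by
      refine h1.trans ?_
      rw [ENNReal.ofReal_mul K₁.coe_nonneg, ENNReal.ofReal_coe_nnreal]
      exact mul_le_mul_right h2 _
    rw [← ofReal_norm, ENNReal.ofReal_le_ofReal_iff (by positivity), Real.norm_eq_abs] at h3
    exact h3
  have hSΨ : ∀ x, ∑ l, |Torus.partialDeriv l (D.Psi x t) y| ≤ 3 * ((K₁ : ℝ) * Φ) := fun x =>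
    (Finset.sum_le_sum fun l _ => hdΨ x l y).trans (le_of_eq (by simp only [Finset.sum_const, Finset.card_univ, Fintype.card_fin, nsmul_eq_mul, Nat.cast_ofNat]))
  refine ⟨?_, ?_, ?_⟩
  · show ‖-∑ x, Torus.expansionRemainder (D.cvec x t) (D.Psi x t) y‖ ≤ _
    rw [norm_neg]
    refine (norm_sum_le _ _).trans (sum_le_NN_mul fun x => ?_)
    have := CL22.norm_expansionRemainder_le (hcv x) ((hΨ x).isContDiff (by simp)) y (by positivity : (0:ℝ) ≤ 27 * H₂)
      (fun l => (norm_cvec_le h hA x ht y l).2)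
    have h7 : ‖Torus.expansionRemainder (D.cvec x t) (D.Psi x t) y‖ ≤ (2 * 3 + 1) * (27 * H₂) * ∑ l, |Torus.partialDeriv l (D.Psi x t) y| := by
      simpa [Fintype.card_fin] using this
    exact h7.trans (mul_le_mul_of_nonneg_left (hSΨ x) (by positivity))
  · show ‖-∑ x, (D.mup⁻¹ * (D.hdot x t y * Jet.fastF (D.J x) D.s x t y)) • dirVec x‖ ≤ _
    rw [norm_neg]
    refine (norm_sum_le _ _).trans (sum_le_NN_mul fun x => ?_)
    have hf0 : 0 ≤ Jet.fastF (D.J x) D.s x t y := by unfold Jet.fastF; positivity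
    have hf1 : Jet.fastF (D.J x) D.s x t y ≤ Φ + 1 := by have := (abs_le.1 (hΦ x y)).2; linarith
    rw [norm_smul, Real.norm_eq_abs, abs_mul, abs_of_pos (inv_pos.2 hmup), abs_mul, abs_of_nonneg hf0]
    calc D.mup⁻¹ * (|D.hdot x t y| * Jet.fastF (D.J x) D.s x t y) * ‖dirVec x‖ ≤ D.mup⁻¹ * (H₁ * (Φ + 1)) * 3 := by
          refine mul_le_mul (mul_le_mul_of_nonneg_left (mul_le_mul (hA.dth_le x t ht y) hf1 hf0 hH1) (by positivity))
            (CL22.norm_dirVec_le x) (norm_nonneg _) (by positivity)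
      _ = _ := by ring
  · refine (pi_norm_le_iff_of_nonneg (by have := one_le_NN; positivity)).2 fun j => ?_
    show ‖∑ x, Torus.expansionTensor (D.cvec x t) (D.Psi x t) y j‖ ≤ _
    refine (norm_sum_le _ _).trans (sum_le_NN_mul fun x => ?_)
    refine (CL22.norm_expansionTensor_apply_le ((hΨ x).isContDiff (by simp)) y j).trans ?_
    exact mul_le_mul (mul_le_mul_of_nonneg_left (norm_cvec_le h hA x ht y 0).1 (by norm_num)) (hSΨ x)
      (Finset.sum_nonneg fun _ _ => abs_nonneg _) (by positivity)

omit hA hB hB1 in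
/-- **The sup size of the new stress at time `t`**, from sizes of the pieces (for the next
mollification). [cite: BuckmasterVicol2020, §7.6.2 (7.48)] -/
theorem norm_newStress_le_sup {ν : ℝ} {v : ℝ → 𝕋³ → E³} {Rc : ℝ → 𝕋³ → Fin 3 → E³} {t : ℝ} (ht : t ∈ Icc 0 D.T)
    {V₀ ρc Sw Sp Sd SS Sf Kℛ : ℝ} (hV : ∀ y, ‖v t y‖ ≤ V₀) (hρ : ∀ y, ‖Rc t y‖ ≤ ρc)
    (hSw : ∀ y, ‖D.w t y‖ ≤ Sw) (hSp : ∀ y, ‖D.wp t y‖ ≤ Sp) (hSd : ∀ i y, ‖Torus.partialDeriv i (D.w' t) y‖ ≤ Sd)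
    (hSS : ∀ y, ‖D.Sosc t y‖ ≤ SS) (hSf : ∀ y, ‖D.ffun t y‖ ≤ Sf)
    (hKℛ : ∀ g : 𝕋³ → E³, Torus.IsSmooth g → ∀ C : ℝ, 0 ≤ C → (∀ y, ‖g y‖ ≤ C) → ∀ y, ‖Torus.antidivergence g y‖ ≤ Kℛ * C)
    (y : 𝕋³) :
    ‖Torus.perturbedStressV ν v D.w' D.zeta (D.S₁ Rc) D.ffun t y‖ ≤
      2 * (ρc + (2 * (Sp * (Sw + Sp)) + (Sw + Sp) ^ 2) + SS) + 4 * (V₀ * Sw) + 4 * |ν| * (3 * Sd) + Kℛ * Sf := by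
  have hw' : Torus.IsSmooth (D.w' t) := (smooth_w' h).isSmooth_slice ht
  have hff : Torus.IsSmooth (D.ffun t) := (smooth_ffun h).isSmooth_slice ht
  have hSf0 : 0 ≤ Sf := (norm_nonneg _).trans (hSf y)
  have hV0 : 0 ≤ V₀ := (norm_nonneg _).trans (hV y)
  have hSw0 : 0 ≤ Sw := (norm_nonneg _).trans (hSw y)
  have hSp0 : 0 ≤ Sp := (norm_nonneg _).trans (hSp y)
  have h0 := Torus.norm_perturbedStressV_le (ν := ν) (u := v) (w' := D.w') (ζ := D.zeta) (S₁ := D.S₁ Rc) (f := D.ffun) (t := t)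
    (hw'.isContDiff (by simp)) y
  have e1 : ‖Torus.incr D.w' D.zeta t y‖ = ‖D.w t y‖ := rfl
  rw [e1] at h0
  -- the pieces
  have hwr : ‖D.wr t y‖ ≤ Sw + Sp := by
    show ‖D.w t y - D.wp t y‖ ≤ _; exact (norm_sub_le _ _).trans (add_le_add (hSw y) (hSp y))
  have hcross : ‖D.cross t y‖ ≤ 2 * (Sp * (Sw + Sp)) + (Sw + Sp) ^ 2 := by
    have e : D.cross t y = Torus.tensorProd (D.wp t) (D.wr t) y + Torus.tensorProd (D.wr t) (D.wp t) y + Torus.tensorProd (D.wr t) (D.wr t) y := by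
      funext j; rfl
    rw [e]
    have hwr0 : 0 ≤ ‖D.wr t y‖ := norm_nonneg _
    calc _ ≤ ‖Torus.tensorProd (D.wp t) (D.wr t) y‖ + ‖Torus.tensorProd (D.wr t) (D.wp t) y‖ + ‖Torus.tensorProd (D.wr t) (D.wr t) y‖ :=
          (norm_add_le _ _).trans (add_le_add (norm_add_le _ _) le_rfl)
      _ ≤ ‖D.wp t y‖ * ‖D.wr t y‖ + ‖D.wr t y‖ * ‖D.wp t y‖ + ‖D.wr t y‖ * ‖D.wr t y‖ :=
          add_le_add (add_le_add (norm_tensorProd_le _ _ y) (norm_tensorProd_le _ _ y)) (norm_tensorProd_le _ _ y)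
      _ ≤ Sp * (Sw + Sp) + (Sw + Sp) * Sp + (Sw + Sp) * (Sw + Sp) :=
          add_le_add (add_le_add (mul_le_mul (hSp y) hwr hwr0 hSp0) (mul_le_mul hwr (hSp y) (norm_nonneg _) (by linarith)))
            (mul_le_mul hwr hwr hwr0 (by linarith))
      _ = _ := by ring
  have hS1 : ‖D.S₁ Rc t y‖ ≤ ρc + (2 * (Sp * (Sw + Sp)) + (Sw + Sp) ^ 2) + SS := by
    have e : D.S₁ Rc t y = Rc t y + D.cross t y + D.Sosc t y := by funext j; rfl
    rw [e]; exact (norm_add_le _ _).trans (add_le_add ((norm_add_le _ _).trans (add_le_add (hρ y) hcross)) (hSS y))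
  have hsum : ∑ i, ‖Torus.partialDeriv i (D.w' t) y‖ ≤ 3 * Sd :=
    (Finset.sum_le_sum fun i _ => hSd i y).trans (le_of_eq (by simp only [Finset.sum_const, Finset.card_univ, Fintype.card_fin, nsmul_eq_mul, Nat.cast_ofNat]))
  have hR : ‖Torus.antidivergence (D.ffun t) y‖ ≤ Kℛ * Sf := hKℛ _ hff Sf hSf0 hSf y
  have hν : 0 ≤ 4 * |ν| := by positivity
  nlinarith [mul_le_mul_of_nonneg_left hS1 (by norm_num : (0:ℝ) ≤ 2), mul_le_mul (hV y) (hSw y) (norm_nonneg _) hV0,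
    mul_le_mul_of_nonneg_left hsum hν, norm_nonneg (v t y), norm_nonneg (D.w t y)]

end Datum

end JetStep

end Literature.Analysis.FluidPDE
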